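import Mathlib
import HarnessLib
import Summits.HubbardSuperconductivity.HubbardSuperconductivity.Theorems.KLProgrammeCutCurrencyLegMassSharp

/-!
# Route `KLProgramme` — ENGINE (stmt-HubbardSuperconductivity-20437 `KLRegimeEngineV17F2`), located #25 «(b)-PLAIN-UV-TAIL», cure (α),
# E1 item (i), THE SHARPER NUMBER: `A(ĝ∘ω) ≤ 8` and `ε³Σ‖W₄(S_ĝV)‖ ≤ (|U|/24)·4096` UNIFORMLY in `128 ≤ β ≤ M`
# (cell gate-hubbard-kl, seat hubbard-kl-k3c2-p2 g35; three-region version of ✓-farm `…LegMassNumeric`'s `15⁴`)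

With the three-region lemma and the total-variation middle region of `…LegMassSharp`:
* `klct_C2S_bounds` — `117 ≤ C₂(β)·S(β) ≤ 362` for `β ≥ 128` (`C₂S = 3K/32 + 27Kπ/(4β) + 48Kπ²/β²`);
* **`klct_legMass_uvCut_le_eight`** — `A ≤ 8` for `128 ≤ β ≤ M` (`J₁ = ⌈N/2S⌉`, `J₂ = ⌈C₂N/8⌉`: `S(2J₁+1)/N ≤ 1 + 3S/N`, `C₂N/(8J₂) ≤ 1`, `J₂ ≤ 128·J₁`,
  `log 128 = 7 log 2 < 4.853`);
* **`klbv_plainCurrency_uvCut_hubbardInteraction_le_sharp`** — `ε_x³ Σ_{x′ : x′_q = y}‖W₄(S_ĝ V)(x′)‖ ≤ (|U|/24)·8⁴` for all `128 ≤ β ≤ M` (every `L`, `U`, `q`, `y`).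
No definition; nothing asserts any row, (b), (C), K3, U₀, the window or superconductivity.
References: BGM 2006 §2.2–2.3 [cite: BenfattoGiulianiMastropietro2006].
-/

noncomputable section

namespace Summit.HubbardSuperconductivity.HubbardSuperconductivity.Theorems.KLRegimeSplit

set_option linter.dupNamespace false -- summit = problem name (single-conjunct summit), D-0017

open Finset Literature.MathematicalPhysics.QuantumLattice Literature.Probability.LatticeModels GrassmannAlgebra

variable {L M : ℕ} [NeZero M]

/-- **`117 ≤ C₂(β)·S(β) ≤ 362` for `β ≥ 128`** (`C₂S = 3K/32 + 27Kπ/(4β) + 48Kπ²/β²`, `K = 11264/9`). -/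
theorem klct_C2S_bounds {β : ℝ} (hβ : 128 ≤ β) :
    117 ≤ (2 * (11264 / 9) * (2 * Real.pi / β) ^ 2 * (3 * β / (32 * Real.pi) + 6)) * (β / (8 * Real.pi) + 1) ∧
      (2 * (11264 / 9) * (2 * Real.pi / β) ^ 2 * (3 * β / (32 * Real.pi) + 6)) * (β / (8 * Real.pi) + 1) ≤ 362 := by
  have hβ0 : 0 < β := by linarith
  have hpi0 := Real.pi_pos
  have hpi := Real.pi_lt_d4
  have hexp : (2 * (11264 / 9) * (2 * Real.pi / β) ^ 2 * (3 * β / (32 * Real.pi) + 6)) * (β / (8 * Real.pi) + 1) =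
      3 * (11264 / 9) / 32 + 27 * (11264 / 9) * Real.pi / (4 * β) + 48 * (11264 / 9) * Real.pi ^ 2 / β ^ 2 := by
    field_simp; ring
  rw [hexp]
  have t2 : 0 ≤ 27 * (11264 / 9 : ℝ) * Real.pi / (4 * β) := by positivity
  have t3 : 0 ≤ 48 * (11264 / 9 : ℝ) * Real.pi ^ 2 / β ^ 2 := by positivity
  have t2' : 27 * (11264 / 9 : ℝ) * Real.pi / (4 * β) ≤ 27 * (11264 / 9 : ℝ) * 3.1416 / (4 * 128) := by
    gcongr
  have t3' : 48 * (11264 / 9 : ℝ) * Real.pi ^ 2 / β ^ 2 ≤ 48 * (11264 / 9 : ℝ) * 3.1416 ^ 2 / 128 ^ 2 := by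
    gcongr
  norm_num at t2' t3' ⊢
  constructor <;> linarith

/-- **`A(ĝ∘ω) ≤ 8` UNIFORMLY IN `128 ≤ β ≤ M`** (three regions: support bound `S`, linear decay from the total variation, quadratic decay from the second differences). -/
theorem klct_legMass_uvCut_le_eight {β : ℝ} (hβ : 128 ≤ β) (hM : β ≤ M) :
    (((2 * M : ℕ) : ℝ))⁻¹ * ∑ j : ImagTimeIdx M, ‖∑ n : MatsubaraIdx M, (((gnScaleCutoff 4 klE0 1 |matsubaraFreq β M n| : ℝ) : ℂ)) *
        Complex.exp (-((2 * Real.pi * ((n : ℕ) : ℝ) * ((j : ℕ) : ℝ) / (2 * M) : ℝ) : ℂ) * Complex.I)‖ ≤ 8 := by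
  have hβ0 : 0 < β := by linarith
  have hβ2 : (2 : ℝ) ≤ β := by linarith
  have hMne := NeZero.ne M
  have hN : 0 < 2 * M := by omega
  have hNr : (0 : ℝ) < ((2 * M : ℕ) : ℝ) := by exact_mod_cast hN
  have hNβ : 2 * β ≤ ((2 * M : ℕ) : ℝ) := by push_cast; linarith
  have hcast : (2 * (M : ℝ)) = ((2 * M : ℕ) : ℝ) := by push_cast; ring
  have hpi0 := Real.pi_pos
  set S : ℝ := β / (8 * Real.pi) + 1 with hS
  set C₂ : ℝ := 2 * (11264 / 9) * (2 * Real.pi / β) ^ 2 * (3 * β / (32 * Real.pi) + 6) with hC₂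
  have hS0 : 0 < S := by positivity
  have hC₂0 : 0 < C₂ := by positivity
  obtain ⟨hCSlo, hCShi⟩ := klct_C2S_bounds hβ
  rw [← hC₂, ← hS] at hCSlo hCShi
  set h : ImagTimeIdx M → ℝ := fun j => ‖∑ n : MatsubaraIdx M, (((gnScaleCutoff 4 klE0 1 |matsubaraFreq β M n| : ℝ) : ℂ)) *
      Complex.exp (-((2 * Real.pi * ((n : ℕ) : ℝ) * ((j : ℕ) : ℝ) / (2 * M) : ℝ) : ℂ) * Complex.I)‖ with hh
  -- region bounds
  have hle : ∀ j, h j ≤ S := by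
    intro j
    refine (norm_sum_le _ _).trans ?_
    have : ∀ n : MatsubaraIdx M, ‖(((gnScaleCutoff 4 klE0 1 |matsubaraFreq β M n| : ℝ) : ℂ)) *
        Complex.exp (-((2 * Real.pi * ((n : ℕ) : ℝ) * ((j : ℕ) : ℝ) / (2 * M) : ℝ) : ℂ) * Complex.I)‖ = gnScaleCutoff 4 klE0 1 |matsubaraFreq β M n| := by
      intro n
      rw [norm_mul, klct_norm_cexp_neg_real_mul_I, mul_one, Complex.norm_real, Real.norm_eq_abs, abs_of_nonneg (klct_uvCutoff_mem_Icc _).1]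
    simp_rw [this]
    exact klct_sum_uvCutoff_le hβ0
  have hmin0 : ∀ j : ImagTimeIdx M, 0 ≤ min ((j : ℕ) : ℝ) (((2 * M : ℕ) : ℝ) - (j : ℕ)) := by
    intro j
    apply le_min (by positivity)
    have : ((j : ℕ) : ℝ) < ((2 * M : ℕ) : ℝ) := by exact_mod_cast j.isLt
    linarith
  have hdec1 : ∀ j : ImagTimeIdx M, ((j : ℕ)) ≠ 0 → h j * (min ((j : ℕ) : ℝ) (((2 * M : ℕ) : ℝ) - (j : ℕ))) ≤ ((2 * M : ℕ) : ℝ) / 2 := by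
    intro j _
    have hlin := klct_legTransform_uvCut_lin_decay hβ2 hM j
    rw [mul_div_assoc', div_le_iff₀ hNr] at hlin
    linarith
  have hdec2 : ∀ j : ImagTimeIdx M, ((j : ℕ)) ≠ 0 → h j * (min ((j : ℕ) : ℝ) (((2 * M : ℕ) : ℝ) - (j : ℕ))) ^ 2 ≤ C₂ * ((2 * M : ℕ) : ℝ) ^ 2 / 16 := by
    intro j _
    set z : ℂ := Complex.exp (-((2 * Real.pi * ((j : ℕ) : ℝ) / ((2 * M : ℕ) : ℝ) : ℝ) : ℂ) * Complex.I) with hz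
    have hzN : z ^ (2 * M) = 1 := klct_rootOfUnity_pow (N := 2 * M) (j : ℕ)
    have hphase : ∀ n : MatsubaraIdx M,
        Complex.exp (-((2 * Real.pi * ((n : ℕ) : ℝ) * ((j : ℕ) : ℝ) / (2 * M) : ℝ) : ℂ) * Complex.I) = z ^ (n : ℕ) := by
      intro n; rw [hcast]; exact klct_legPhase_eq_pow (N := 2 * M) (n : ℕ) (j : ℕ)
    have hhz : h j = ‖∑ n : MatsubaraIdx M, (((gnScaleCutoff 4 klE0 1 |matsubaraFreq β M n| : ℝ) : ℂ)) * z ^ (n : ℕ)‖ := by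
      simp only [hh]; simp_rw [hphase]
    have hgap := klct_rootOfUnity_gap (N := 2 * M) hN j.isLt
    have hsbp := klct_normSq_mul_norm_sum_le_secondDiff (fun n : MatsubaraIdx M => (((gnScaleCutoff 4 klE0 1 |matsubaraFreq β M n| : ℝ) : ℂ))) z hzN
    have hC : ∑ v : MatsubaraIdx M, ‖(((gnScaleCutoff 4 klE0 1 |matsubaraFreq β M (v - 1 - 1)| : ℝ) : ℂ)) -
        2 * (((gnScaleCutoff 4 klE0 1 |matsubaraFreq β M (v - 1)| : ℝ) : ℂ)) + (((gnScaleCutoff 4 klE0 1 |matsubaraFreq β M v| : ℝ) : ℂ))‖ ≤ C₂ :=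
      klct_secondDiffSum_uvCut_le hβ hM
    have h0 : 0 ≤ h j := norm_nonneg _
    have hstep : (4 * min ((j : ℕ) : ℝ) (((2 * M : ℕ) : ℝ) - (j : ℕ)) / ((2 * M : ℕ) : ℝ)) ^ 2 * h j ≤ C₂ := by
      calc _ ≤ ‖z - 1‖ ^ 2 * h j := by
            apply mul_le_mul_of_nonneg_right _ h0
            exact pow_le_pow_left₀ (by have := hmin0 j; positivity) hgap 2
        _ ≤ _ := by rw [hhz]; exact hsbp.trans hC
    have hre : (4 * min ((j : ℕ) : ℝ) (((2 * M : ℕ) : ℝ) - (j : ℕ)) / ((2 * M : ℕ) : ℝ)) ^ 2 * h j =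
        16 * (h j * (min ((j : ℕ) : ℝ) (((2 * M : ℕ) : ℝ) - (j : ℕ))) ^ 2) / ((2 * M : ℕ) : ℝ) ^ 2 := by
      field_simp
      ring
    rw [hre, div_le_iff₀ (by positivity)] at hstep
    linarith
  -- the scales
  set J₁ : ℕ := ⌈(((2 * M : ℕ) : ℝ) / (2 * S))⌉₊ with hJ₁
  set J₂ : ℕ := ⌈(C₂ * ((2 * M : ℕ) : ℝ) / 8)⌉₊ with hJ₂
  have harg1 : 0 < ((2 * M : ℕ) : ℝ) / (2 * S) := by positivity
  have harg2 : 0 < C₂ * ((2 * M : ℕ) : ℝ) / 8 := by positivity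
  have hJ₁1 : 1 ≤ J₁ := Nat.succ_le_of_lt (Nat.ceil_pos.mpr harg1)
  have hJ₁lo : ((2 * M : ℕ) : ℝ) / (2 * S) ≤ (J₁ : ℝ) := Nat.le_ceil _
  have hJ₁hi : (J₁ : ℝ) < ((2 * M : ℕ) : ℝ) / (2 * S) + 1 := Nat.ceil_lt_add_one harg1.le
  have hJ₂lo : C₂ * ((2 * M : ℕ) : ℝ) / 8 ≤ (J₂ : ℝ) := Nat.le_ceil _
  have hJ₂hi : (J₂ : ℝ) < C₂ * ((2 * M : ℕ) : ℝ) / 8 + 1 := Nat.ceil_lt_add_one harg2.le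
  have hJ₁pos : (0 : ℝ) < J₁ := by exact_mod_cast hJ₁1
  have hJ12 : J₁ ≤ J₂ := by
    apply Nat.ceil_mono
    rw [div_le_div_iff₀ (by positivity) (by norm_num)]
    have hp : 4 * ((2 * M : ℕ) : ℝ) ≤ C₂ * S * ((2 * M : ℕ) : ℝ) := mul_le_mul_of_nonneg_right (by linarith) hNr.le
    linarith
  have hJ₂pos : (0 : ℝ) < J₂ := by exact_mod_cast (lt_of_lt_of_le hJ₁1 hJ12)
  -- the three-region lemma
  have hsum := klct_sum_le_of_three_regions (N := 2 * M) h hS0.le (by positivity : (0:ℝ) ≤ ((2 * M : ℕ) : ℝ) / 2)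
    (by positivity : 0 ≤ C₂ * ((2 * M : ℕ) : ℝ) ^ 2 / 16) hle hdec1 hdec2 hJ₁1 hJ12
  -- the pieces
  have hSN : S ≤ 3 / 125 * ((2 * M : ℕ) : ℝ) := by
    have h25 : β / (8 * Real.pi) ≤ β / 25 :=
      div_le_div_of_nonneg_left hβ0.le (by norm_num) (by nlinarith [Real.pi_gt_d2])
    have : S ≤ β / 25 + 1 := by rw [hS]; linarith
    linarith
  have p1 : S * (2 * (J₁ : ℝ) + 1) ≤ 1072 / 1000 * ((2 * M : ℕ) : ℝ) := by
    have hle1 : S * (2 * (J₁ : ℝ) + 1) ≤ S * (2 * (((2 * M : ℕ) : ℝ) / (2 * S) + 1) + 1) := by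
      have := hJ₁hi.le
      gcongr
    have e : S * (2 * (((2 * M : ℕ) : ℝ) / (2 * S) + 1) + 1) = ((2 * M : ℕ) : ℝ) + 3 * S := by field_simp; ring
    rw [e] at hle1
    linarith
  have p2 : 2 * (C₂ * ((2 * M : ℕ) : ℝ) ^ 2 / 16) / (J₂ : ℝ) ≤ ((2 * M : ℕ) : ℝ) := by
    rw [div_le_iff₀ hJ₂pos]
    have hp : ((2 * M : ℕ) : ℝ) * (C₂ * ((2 * M : ℕ) : ℝ) / 8) ≤ ((2 * M : ℕ) : ℝ) * (J₂ : ℝ) := mul_le_mul_of_nonneg_left hJ₂lo hNr.le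
    have e : 2 * (C₂ * ((2 * M : ℕ) : ℝ) ^ 2 / 16) = ((2 * M : ℕ) : ℝ) * (C₂ * ((2 * M : ℕ) : ℝ) / 8) := by ring
    rw [e]
    linarith
  have p3 : Real.log ((J₂ : ℝ) / J₁) ≤ 4853 / 1000 := by
    have h64 : C₂ * ((2 * M : ℕ) : ℝ) / 8 + 1 ≤ 128 * (((2 * M : ℕ) : ℝ) / (2 * S)) := by
      rw [show (128 : ℝ) * (((2 * M : ℕ) : ℝ) / (2 * S)) = 64 * ((2 * M : ℕ) : ℝ) / S by field_simp; ring, le_div_iff₀ hS0]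
      have e : (C₂ * ((2 * M : ℕ) : ℝ) / 8 + 1) * S = C₂ * S * ((2 * M : ℕ) : ℝ) / 8 + S := by ring
      have hp : C₂ * S * ((2 * M : ℕ) : ℝ) ≤ 362 * ((2 * M : ℕ) : ℝ) := mul_le_mul_of_nonneg_right hCShi hNr.le
      rw [e]
      linarith
    have hratio : (J₂ : ℝ) / J₁ ≤ 128 := by
      rw [div_le_iff₀ hJ₁pos]
      linarith
    have hlog := Real.log_le_log (by positivity) hratio
    have h128 : Real.log (128 : ℝ) = 7 * Real.log 2 := by
      rw [show (128 : ℝ) = 2 ^ 7 by norm_num, Real.log_pow]; norm_num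
    have h2 := Real.log_two_lt_d9
    rw [h128] at hlog
    linarith
  -- assemble: `Σ h ≤ 1.072N + N(1 + 4.853) + N ≤ 8N`
  rw [inv_mul_le_iff₀ hNr]
  refine hsum.trans ?_
  have hNlog : ((2 * M : ℕ) : ℝ) * Real.log ((J₂ : ℝ) / J₁) ≤ ((2 * M : ℕ) : ℝ) * (4853 / 1000) := mul_le_mul_of_nonneg_left p3 hNr.le
  have e2 : 2 * (((2 * M : ℕ) : ℝ) / 2) * (1 + Real.log ((J₂ : ℝ) / J₁)) = ((2 * M : ℕ) : ℝ) + ((2 * M : ℕ) : ℝ) * Real.log ((J₂ : ℝ) / J₁) := by ring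
  rw [e2]
  linarith

/-- **E1 ITEM (i), THE SHARPER NUMBER: `ε_x³ Σ_{x′ : x′_q = y}‖W₄(S_ĝ V)(x′)‖ ≤ (|U|/24)·8⁴` UNIFORMLY in `128 ≤ β ≤ M`** (every `L`, `U`, pinned leg `q`, pin `y`). -/
theorem klbv_plainCurrency_uvCut_hubbardInteraction_le_sharp [NeZero L] {β : ℝ} (hβ : 128 ≤ β) (hM : β ≤ M) (U : ℝ) (q : Fin 4) (y : SpaceTimeIdx L M) :
    imagTimeWeight β M ^ 3 *
        ∑ x ∈ univ.filter (fun x : Fin 4 → SpaceTimeIdx L M => x q = y),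
          ‖sectorisedKernel L M β (trivialMultiplier L M)
            (ExteriorAlgebra.map (LinearMap.mulLeft ℂ (fun K : HubbardFieldIdx L M => ((gnScaleCutoff 4 klE0 1 |matsubaraFreq β M K.1.1.1| : ℝ) : ℂ))) (hubbardInteraction L M β U)) 4
            (![(((0 : Fin 1), (0 : Fin 2)), (0 : Fin 2)), ((0, 0), 1), ((0, 1), 0), ((0, 1), 1)] : Fin 4 → SectorLeg 1) x‖ ≤
      |U| / 24 * 8 ^ 4 := by
  refine (klbv_plainCurrency_uvCut_hubbardInteraction_le_legMass_pow_four (by linarith) hM U q y).trans ?_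
  have hA0 : 0 ≤ (((2 * M : ℕ) : ℝ))⁻¹ * ∑ j : ImagTimeIdx M, ‖∑ n : MatsubaraIdx M, (((gnScaleCutoff 4 klE0 1 |matsubaraFreq β M n| : ℝ) : ℂ)) *
      Complex.exp (-((2 * Real.pi * ((n : ℕ) : ℝ) * ((j : ℕ) : ℝ) / (2 * M) : ℝ) : ℂ) * Complex.I)‖ :=
    mul_nonneg (inv_nonneg.mpr (by positivity)) (Finset.sum_nonneg (fun _ _ => norm_nonneg _))
  gcongr
  exact klct_legMass_uvCut_le_eight hβ hM

end Summit.HubbardSuperconductivity.HubbardSuperconductivity.Theorems.KLRegimeSplit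

end
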